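import Summits.QuantumFields.YangMills.Theorems.AllWindowsColdBoxBoxHighLineRestrictionSetCrossParity
import Summits.QuantumFields.YangMills.Theorems.AllWindowsColdBoxBoxHighLineTiltUParitySizes
import Summits.QuantumFields.YangMills.Theorems.AllWindowsColdBoxBoxHighLinePlaqCostMomentsOnD
import Summits.QuantumFields.YangMills.Theorems.AllWindowsColdBoxBoxHighLinePlaqCostSizesOnD

/-!
# U5 K4′(b), rows R6/R7 BY NAME: the CROSS term `CROSS_{Uᵒ}(c_x, c_y; Uᵒ, Uᵉ)` over a symmetric cut set in β-letters

Free-hands helper of LEAD ym-line-sfw-p2 g78 for Steps D–E of the NEXT rung U5 (`stub_landauThirdOrder`, LINE-20, ⟨stmt-QuantumFields-24336⟩); the LAST term of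
the row decomposition ✓`GaussRestrict.abs_tiltCum4_muSet_zero_le_rows` / ✓`GaussNormalForm.abs_tiltCum4_muSet_tiltU_le_rows` (p754020), discharged with
fcl-p3 g27's ✓`GaussRestrict.abs_cross_muSet_zero_parity_le_gaussAvg` (parity kills five of nine pieces) and the landed size letters:
`sup|cᵉ| ≤ 116 s²` (✓`TiltSup.abs_chartPlaqCost_le`), `E₀[sfInd·(cᵒ)⁴] ≤ C s⁶/β³` (✓13K-G `gaussAvg_sfInd_odd_pow_four_le`), `E₀[(cᵒ)²] ≤ C/β³` (✓`plaquetteObsL2`),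
`E₀[1_D Uᵒ⁴] ≤ K²·E₀[sfInd·Uᵒ²]` (`|Uᵒ| ≤ K` on `D`) with `E₀[sfInd·Uᵒ²] ≤ C L^m (H⁴/β + H¹²s⁶ + H⁸s⁸)` and `E₀[sfInd·(Uᵉ − b)²] ≤ C L^m (H⁸/β² + H¹²s⁶ + H⁸s⁸)`
(✓13K-U parity sizes `gaussAvg_sfInd_mul_sq_tiltU_parity_le`):

* `sqrt_mul_le_of_one_le`, `sqrt_sqrt_mul_le_of_one_le` — `√(c z) ≤ c √z`, `√(√(c z)) ≤ c √(√z)` for `c ≥ 1`;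
* `chartPlaqCostEven_neg` — the even part `c − cᵒ` is even;
* ★★ `GaussNormalForm.abs_cross_muSet_chartPlaqCost_tiltU_parity_le` — for `H ≥ 1`, `H⁴ ≤ β`, `0 ≤ s ≤ 1`, `s·H² ≤ c₀`, a measurable SYMMETRIC `D ⊆ smallField H s` with
  `sup_D|tiltU| ≤ K`, `E₀[1 − 1_D] ≤ τ ≤ 1/2`, all `x y`:
  `|CROSS_{Uᵒ}(c_x, c_y; Uᵒ, Uᵉ)| ≤ C·(1+log H)^m·s²·(√(√(s⁶/β³·(K²·X₄))) + √(X₄/β³))·√X₈`, `X₄ := H⁴/β + H¹²s⁶ + H⁸s⁸`, `X₈ := H⁸/β² + H¹²s⁶ + H⁸s⁸`,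
  the CROSS written VERBATIM as in the rows lemma (letter `EO := Tilt.tiltExp μ_D Uᵒ 0`, slots `chartPlaqCost · 1 2` unsplit).
  HIGH-window relative size (`s = β^{−1/2+κ₃}`, `H ≤ β^θ+1`, `K = 2`): `H¹³β^{−7/4+3.5κ₃} + H¹⁵β^{−9/4+5κ₃} + H¹⁴β^{−2+3.5κ₃} + …` (·polylog) → 0 at `κ₃ = 1/8 − θ/4`, `θ < 1/10`.

No definitions; standard axioms.  HONEST LABEL: helper-grade U5 prep; U5, ⟨24004⟩, ⟨24336⟩ remain OPEN; route AllWindowsColdBox is DRAFT; no crux, rung or summit is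
proved; **the Yang–Mills mass gap is NOT proved by this file; no summit is proved by a line.**
-/

set_option autoImplicit false

noncomputable section

open MeasureTheory Set
open Literature.Probability.LatticeModels (Site)

namespace Summit.QuantumFields.YangMills.Theorems.AllWindowsColdBoxBoxHighLine

namespace GaussNormalForm

/-- `√(c·z) ≤ c·√z` for `c ≥ 1`. -/
theorem sqrt_mul_le_of_one_le {c : ℝ} (hc : 1 ≤ c) (z : ℝ) : Real.sqrt (c * z) ≤ c * Real.sqrt z := by
  rw [Real.sqrt_mul (by linarith) z]
  refine mul_le_mul_of_nonneg_right (Real.sqrt_le_iff.2 ⟨by linarith, by nlinarith⟩) (Real.sqrt_nonneg _)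

/-- `√(√(c·z)) ≤ c·√(√z)` for `c ≥ 1`. -/
theorem sqrt_sqrt_mul_le_of_one_le {c : ℝ} (hc : 1 ≤ c) (z : ℝ) : Real.sqrt (Real.sqrt (c * z)) ≤ c * Real.sqrt (Real.sqrt z) := by
  have h1 : Real.sqrt (c * z) ≤ c * Real.sqrt z := sqrt_mul_le_of_one_le hc z
  exact (Real.sqrt_le_sqrt h1).trans (sqrt_mul_le_of_one_le hc _)

/-- The even part `c − cᵒ` of the plaquette cost is even. -/
theorem chartPlaqCostEven_neg (H : ℕ) (x : Site 4) (μ ν : Fin 4) (a : LandauFree H → E3) :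
    chartPlaqCost H x μ ν (-a) - chartPlaqCostOdd H x μ ν (-a) = chartPlaqCost H x μ ν a - chartPlaqCostOdd H x μ ν a := by
  unfold chartPlaqCostOdd
  simp only [neg_neg]
  ring

/-- ★★ **K4′(b) rows R6/R7 BY NAME — the odd/even CROSS term of `κ₄,₀` over a symmetric cut set, in β-letters.** -/
theorem abs_cross_muSet_chartPlaqCost_tiltU_parity_le :
    ∃ C c₀ : ℝ, ∃ m : ℕ, 0 ≤ C ∧ 0 < c₀ ∧ ∀ H : ℕ, 1 ≤ H → ∀ β : ℝ, (H : ℝ) ^ 4 ≤ β → ∀ s : ℝ, 0 ≤ s → s ≤ 1 → s * (H : ℝ) ^ 2 ≤ c₀ →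
      ∀ D : Set (LandauFree H → E3), MeasurableSet D → D ⊆ smallField H s → (∀ a, -a ∈ D ↔ a ∈ D) →
      ∀ K : ℝ, 0 ≤ K → (∀ a ∈ D, |tiltU β H a| ≤ K) →
      ∀ τ : ℝ, gaussAvg β H (fun a => 1 - D.indicator (fun _ => (1 : ℝ)) a) ≤ τ → τ ≤ 1 / 2 → ∀ x y : Site 4,
        let μD : Measure (LandauFree H → E3) := (((volume : Measure (LandauFree H → E3)).restrict D).withDensity fun a => ENNReal.ofReal (gaussWeight β H a))
        let U : (LandauFree H → E3) → ℝ := tiltU β H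
        let Uo : (LandauFree H → E3) → ℝ := fun a => (U a - U (-a)) / 2
        let Ue : (LandauFree H → E3) → ℝ := fun a => (U a + U (-a)) / 2
        let X : (LandauFree H → E3) → ℝ := chartPlaqCost H x 1 2
        let Y : (LandauFree H → E3) → ℝ := chartPlaqCost H y 1 2
        let EO : ((LandauFree H → E3) → ℝ) → ℝ := fun G => Tilt.tiltExp μD Uo 0 G
        |EO (fun a => (X a - EO X) * (Y a - EO Y) * (Uo a - EO Uo) * (Ue a - EO Ue)) - EO (fun a => (X a - EO X) * (Y a - EO Y)) * EO (fun a => (Uo a - EO Uo) * (Ue a - EO Ue))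
            - EO (fun a => (X a - EO X) * (Uo a - EO Uo)) * EO (fun a => (Y a - EO Y) * (Ue a - EO Ue))
            - EO (fun a => (X a - EO X) * (Ue a - EO Ue)) * EO (fun a => (Y a - EO Y) * (Uo a - EO Uo))| ≤
          C * (1 + Real.log H) ^ m * s ^ 2 *
            (Real.sqrt (Real.sqrt (s ^ 6 / β ^ 3 * (K ^ 2 * ((H : ℝ) ^ 4 / β + (H : ℝ) ^ 12 * s ^ 6 + (H : ℝ) ^ 8 * s ^ 8)))) +
              Real.sqrt (((H : ℝ) ^ 4 / β + (H : ℝ) ^ 12 * s ^ 6 + (H : ℝ) ^ 8 * s ^ 8) / β ^ 3)) *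
            Real.sqrt ((H : ℝ) ^ 8 / β ^ 2 + (H : ℝ) ^ 12 * s ^ 6 + (H : ℝ) ^ 8 * s ^ 8) := by
  obtain ⟨CP, c₀, m, hc₀, hP⟩ := gaussAvg_sfInd_mul_sq_tiltU_parity_le
  obtain ⟨CT, cT, mT, hcT, hT⟩ := TiltSup.abs_tiltU_le_of ghostTaylor
  obtain ⟨Co, hCo0, hCo⟩ := TiltSup.gaussAvg_sfInd_odd_pow_four_le
  obtain ⟨C₂, h₂⟩ := plaquetteObsL2
  -- `CP ≥ 0`, `C₂ ≥ 0` read off at `H = 1`, `β = 1`, `s = 0`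
  have hCP : 0 ≤ CP := by
    obtain ⟨b, -, h, -⟩ := hP 1 le_rfl 1 (by norm_num) 0 le_rfl zero_le_one (by simpa using hc₀.le)
    have h0 : 0 ≤ gaussAvg 1 1 (fun a => sfInd 1 0 a * ((tiltU 1 1 a - tiltU 1 1 (-a)) / 2) ^ 2) :=
      EdgeChartGaussian.gaussAvg_nonneg 1 one_pos fun a => mul_nonneg (TiltSup.sfInd_nonneg_le_one (H := 1) 0 a).1 (sq_nonneg _)
    have := h0.trans h
    norm_num at this
    linarith
  have hC₂ : 0 ≤ C₂ := by
    have h := (h₂ 1 le_rfl 1 le_rfl 0).2.1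
    have h0 : 0 ≤ gaussAvg 1 1 (fun a => chartPlaqCostOdd 1 0 1 2 a ^ 2) := EdgeChartGaussian.gaussAvg_nonneg 1 one_pos fun a => sq_nonneg _
    have := h0.trans h
    norm_num at this
    linarith
  -- constants ≥ 1 absorbing the letter constants
  set c₁ : ℝ := max 1 (4 * Co * CP) with hc₁
  set c₂ : ℝ := max 1 (2 * CP) with hc₂
  set c₃ : ℝ := max 1 (4 * C₂ * CP) with hc₃
  have hc₁1 : 1 ≤ c₁ := le_max_left _ _
  have hc₂1 : 1 ≤ c₂ := le_max_left _ _
  have hc₃1 : 1 ≤ c₃ := le_max_left _ _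
  refine ⟨464 * (c₁ * c₂ + c₃ * c₂), min c₀ cT, 2 * m, by positivity, lt_min hc₀ hcT,
    fun H hH β hβ s hs0 hs1 hsH D hDm hDs hsym K hK hUK τ hτ hτ2 x y => ?_⟩
  intro μD U Uo Ue X Y EO
  have hH1 : (1 : ℝ) ≤ H := by exact_mod_cast hH
  have hβ1 : 1 ≤ β := (one_le_pow₀ (M₀ := ℝ) hH1 (n := 4)).trans hβ
  have hβ0 : 0 < β := by linarith
  set L : ℝ := 1 + Real.log H with hL
  have hL1 : 1 ≤ L := by have := Real.log_nonneg hH1; rw [hL]; linarith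
  have hLm1 : 1 ≤ L ^ m := one_le_pow₀ hL1
  set X4 : ℝ := (H : ℝ) ^ 4 / β + (H : ℝ) ^ 12 * s ^ 6 + (H : ℝ) ^ 8 * s ^ 8 with hX4
  set X8 : ℝ := (H : ℝ) ^ 8 / β ^ 2 + (H : ℝ) ^ 12 * s ^ 6 + (H : ℝ) ^ 8 * s ^ 8 with hX8
  have hX40 : 0 ≤ X4 := by positivity
  have hX80 : 0 ≤ X8 := by positivity
  obtain ⟨b, hbe, hbo, -⟩ := hP H hH β hβ s hs0 hs1 (hsH.trans (min_le_left _ _))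
  have hTs0 := hT H hH β s hs0 hs1 (hsH.trans (min_le_right _ _))
  set T : ℝ := CT * (1 + Real.log H) ^ mT * (|β| * (H : ℝ) ^ 4 * s ^ 3 + (H : ℝ) ^ 6 * s ^ 2) with hTdef
  -- record the definitional facts about the tilt letters, then make them OPAQUE (unfolding `tiltU` under `isDefEq` is prohibitive)
  have hUo : ∀ a, Uo a = (U a - U (-a)) / 2 := fun a => rfl
  have hUe : ∀ a, Ue a = (U a + U (-a)) / 2 := fun a => rfl
  have hUK' : ∀ a ∈ D, |U a| ≤ K := hUK
  have hTs : ∀ a ∈ smallField H s, |U a| ≤ T := hTs0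
  have mU : Measurable U := measurable_tiltU β H
  have hbo' : gaussAvg β H (fun a => sfInd H s a * Uo a ^ 2) ≤ CP * L ^ m * X4 := hbo
  have hbe' : gaussAvg β H (fun a => sfInd H s a * (Ue a - b) ^ 2) ≤ CP * L ^ m * X8 := hbe
  clear hbo hbe hTs0 hUK
  clear_value Uo Ue U
  -- the parity split of the plaquette costs
  set Xe : (LandauFree H → E3) → ℝ := fun a => chartPlaqCost H x 1 2 a - chartPlaqCostOdd H x 1 2 a with hXe
  set Xo : (LandauFree H → E3) → ℝ := chartPlaqCostOdd H x 1 2 with hXo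
  set Ye : (LandauFree H → E3) → ℝ := fun a => chartPlaqCost H y 1 2 a - chartPlaqCostOdd H y 1 2 a with hYe
  set Yo : (LandauFree H → E3) → ℝ := chartPlaqCostOdd H y 1 2 with hYo
  have eX : X = fun a => Xe a + Xo a := funext fun a => by simp only [hXe, hXo]; show chartPlaqCost H x 1 2 a = _; ring
  have eY : Y = fun a => Ye a + Yo a := funext fun a => by simp only [hYe, hYo]; show chartPlaqCost H y 1 2 a = _; ring
  rw [eX, eY]
  -- parities
  have pXe : ∀ a, Xe (-a) = Xe a := fun a => chartPlaqCostEven_neg H x 1 2 a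
  have pYe : ∀ a, Ye (-a) = Ye a := fun a => chartPlaqCostEven_neg H y 1 2 a
  have pXo : ∀ a, Xo (-a) = -Xo a := fun a => EdgeChartGaussian.chartPlaqCostOdd_neg x 1 2 a
  have pYo : ∀ a, Yo (-a) = -Yo a := fun a => EdgeChartGaussian.chartPlaqCostOdd_neg y 1 2 a
  have pUo : ∀ a, Uo (-a) = -Uo a := fun a => by rw [hUo, hUo, neg_neg]; ring
  have pUe : ∀ a, Ue (-a) = Ue a := fun a => by rw [hUe, hUe, neg_neg]; ring
  -- measurability
  have mc : ∀ z : Site 4, Measurable (chartPlaqCost H z 1 2) := fun z => EdgeChartGaussian.measurable_chartPlaqCost H z 1 2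
  have mco : ∀ z : Site 4, Measurable (chartPlaqCostOdd H z 1 2) := fun z => EdgeChartGaussian.measurable_chartPlaqCostOdd H z 1 2
  have mXe : Measurable Xe := (mc x).sub (mco x)
  have mYe : Measurable Ye := (mc y).sub (mco y)
  have mneg : Measurable fun a : LandauFree H → E3 => U (-a) := mU.comp measurable_neg
  have mUo : Measurable Uo := by rw [funext hUo]; exact (mU.sub mneg).div_const 2
  have mUe : Measurable Ue := by rw [funext hUe]; exact (mU.add mneg).div_const 2
  -- bounds on `D` (common bound `B := 120 + K`, sup bounds `116 s²`)
  have hs2 : s ^ 2 ≤ 1 := pow_le_one₀ hs0 hs1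
  have bc : ∀ z : Site 4, ∀ a ∈ D, |chartPlaqCost H z 1 2 a| ≤ 116 * s ^ 2 := fun z a ha => TiltSup.abs_chartPlaqCost_le hs0 hs1 (hDs ha) z 1 2
  have bc' : ∀ z : Site 4, ∀ a ∈ D, |chartPlaqCost H z 1 2 (-a)| ≤ 116 * s ^ 2 := fun z a ha =>
    TiltSup.abs_chartPlaqCost_le hs0 hs1 (hDs ((hsym a).2 ha)) z 1 2
  have be : ∀ z : Site 4, ∀ a ∈ D, |chartPlaqCost H z 1 2 a - chartPlaqCostOdd H z 1 2 a| ≤ 116 * s ^ 2 := fun z a ha => by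
    have e : chartPlaqCost H z 1 2 a - chartPlaqCostOdd H z 1 2 a = (chartPlaqCost H z 1 2 a + chartPlaqCost H z 1 2 (-a)) / 2 := by
      unfold chartPlaqCostOdd; ring
    rw [e, abs_div, abs_two]
    linarith [abs_add_le (chartPlaqCost H z 1 2 a) (chartPlaqCost H z 1 2 (-a)), bc z a ha, bc' z a ha]
  have bo : ∀ z : Site 4, ∀ a ∈ D, |chartPlaqCostOdd H z 1 2 a| ≤ 120 + K := fun z a _ =>
    (EdgeChartGaussian.abs_chartPlaqCostOdd_le H z 1 2 a).trans (by linarith)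
  have h116 : 116 * s ^ 2 ≤ 120 + K := by
    have := mul_le_mul_of_nonneg_left hs2 (by norm_num : (0 : ℝ) ≤ 116); linarith
  have beB : ∀ z : Site 4, ∀ a ∈ D, |chartPlaqCost H z 1 2 a - chartPlaqCostOdd H z 1 2 a| ≤ 120 + K := fun z a ha =>
    (be z a ha).trans h116
  have bUo : ∀ a ∈ D, |Uo a| ≤ K := fun a ha => by
    rw [hUo, abs_div, abs_two]; linarith [abs_sub (U a) (U (-a)), hUK' a ha, hUK' (-a) ((hsym a).2 ha)]
  have bUe : ∀ a ∈ D, |Ue a| ≤ K := fun a ha => by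
    rw [hUe, abs_div, abs_two]; linarith [abs_add_le (U a) (U (-a)), hUK' a ha, hUK' (-a) ((hsym a).2 ha)]
  have bUoB : ∀ a ∈ D, |Uo a| ≤ 120 + K := fun a ha => (bUo a ha).trans (by linarith)
  have bUeB : ∀ a ∈ D, |Ue a| ≤ 120 + K := fun a ha => (bUe a ha).trans (by linarith)
  have hB0 : (0 : ℝ) ≤ 120 + K := by linarith
  have hS0 : (0 : ℝ) ≤ 116 * s ^ 2 := by positivity
  -- fcl-p3's parity-reduced Hölder bound
  have h := GaussRestrict.abs_cross_muSet_zero_parity_le_gaussAvg hβ0 hDm hsym hτ hτ2 Uo hB0 hS0 hS0 mXe (mco x) mYe (mco y) mUo mUe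
    (beB x) (bo x) (beB y) (bo y) bUoB bUeB (be x) (be y) pXe pXo pYe pYo pUo pUe b
  dsimp only at h
  refine h.trans ?_
  -- ### the five Gaussian sizes
  have hsf := fun a : LandauFree H → E3 => TiltSup.sfInd_nonneg_le_one (H := H) s a
  have ind_le : ∀ {G : (LandauFree H → E3) → ℝ}, (∀ a, 0 ≤ G a) → ∀ a, D.indicator (fun _ => (1 : ℝ)) a * G a ≤ sfInd H s a * G a := by
    intro G hG a
    refine mul_le_mul_of_nonneg_right ?_ (hG a)
    by_cases ha : a ∈ D
    · rw [Set.indicator_of_mem ha, TiltSup.sfInd_of_mem (hDs ha)]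
    · rw [Set.indicator_of_notMem ha]; exact (hsf a).1
  have ind0 : ∀ {G : (LandauFree H → E3) → ℝ}, (∀ a, 0 ≤ G a) → ∀ a, 0 ≤ D.indicator (fun _ => (1 : ℝ)) a * G a :=
    fun hG a => mul_nonneg (GaussRestrict.indicator_one_nonneg_le_one D a).1 (hG a)
  -- (i) odd plaquette cost, fourth moment
  have iO4 : ∀ z : Site 4, Integrable fun a => sfInd H s a * chartPlaqCostOdd H z 1 2 a ^ 4 * gaussWeight β H a := fun z =>
    Tilt.integrable_sfInd_mul H hβ0 s ((mco z).pow_const 4) (by norm_num : (0 : ℝ) ≤ 4 ^ 4) fun a _ => by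
      rw [abs_pow]; exact pow_le_pow_left₀ (abs_nonneg _) (EdgeChartGaussian.abs_chartPlaqCostOdd_le H z 1 2 a) 4
  have sO4 : ∀ z : Site 4, gaussAvg β H (fun a => D.indicator (fun _ => (1 : ℝ)) a * chartPlaqCostOdd H z 1 2 a ^ 4) ≤ Co * s ^ 6 / β ^ 3 := fun z =>
    (EdgeChartGaussian.gaussAvg_mono_of_nonneg H hβ0 (ind0 fun a => by positivity) (ind_le fun a => by positivity) (iO4 z)).trans
      (hCo H hH β hβ1 s hs0 hs1 z)
  -- (ii) odd plaquette cost, second moment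
  have iO2 : ∀ z : Site 4, Integrable fun a => chartPlaqCostOdd H z 1 2 a ^ 2 * gaussWeight β H a := fun z =>
    Tilt.integrable_bdd_mul_gaussWeight H hβ0 ((mco z).pow_const 2) (C := 4 ^ 2) fun a => by
      rw [abs_pow]; exact pow_le_pow_left₀ (abs_nonneg _) (EdgeChartGaussian.abs_chartPlaqCostOdd_le H z 1 2 a) 2
  have sO2 : ∀ z : Site 4, gaussAvg β H (fun a => D.indicator (fun _ => (1 : ℝ)) a * chartPlaqCostOdd H z 1 2 a ^ 2) ≤ C₂ / β ^ 3 := fun z => by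
    refine (EdgeChartGaussian.gaussAvg_mono_of_nonneg H hβ0 (ind0 fun a => by positivity) (fun a => ?_) (iO2 z)).trans (h₂ H hH β hβ1 z).2.1
    calc D.indicator (fun _ => (1 : ℝ)) a * chartPlaqCostOdd H z 1 2 a ^ 2 ≤ 1 * chartPlaqCostOdd H z 1 2 a ^ 2 :=
        mul_le_mul_of_nonneg_right (GaussRestrict.indicator_one_nonneg_le_one D a).2 (sq_nonneg _)
      _ = _ := one_mul _
  -- (iii)/(iv) the odd tilt part: `E₀[1_D Uo²] ≤ CP L^m X4`, `E₀[1_D Uo⁴] ≤ K²·CP L^m X4`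
  have bUos : ∀ a ∈ smallField H s, |Uo a| ≤ T := fun a ha => by
    have h1 := hTs a ha
    have h2 := hTs (-a) ((EdgeChartGaussian.neg_mem_smallField_iff s a).2 ha)
    rw [hUo, abs_div, abs_two]; linarith [abs_sub (U a) (U (-a))]
  have iUo2 : Integrable fun a => sfInd H s a * Uo a ^ 2 * gaussWeight β H a :=
    Tilt.integrable_sfInd_mul H hβ0 s (mUo.pow_const 2) (sq_nonneg T) fun a ha => by
      rw [abs_pow]; exact pow_le_pow_left₀ (abs_nonneg _) (bUos a ha) 2
  have sUo2 : gaussAvg β H (fun a => D.indicator (fun _ => (1 : ℝ)) a * Uo a ^ 2) ≤ CP * L ^ m * X4 :=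
    (EdgeChartGaussian.gaussAvg_mono_of_nonneg H hβ0 (ind0 fun a => sq_nonneg _) (ind_le fun a => sq_nonneg _) iUo2).trans hbo'
  have iUo2D : Integrable fun a => D.indicator (fun _ => (1 : ℝ)) a * Uo a ^ 2 * gaussWeight β H a :=
    GaussRestrict.integrable_indicator_mul_of_bdd hβ0 hDm (mUo.pow_const 2) (sq_nonneg K) fun a ha => by
      rw [abs_pow]; exact pow_le_pow_left₀ (abs_nonneg _) (bUo a ha) 2
  have sUo4 : gaussAvg β H (fun a => D.indicator (fun _ => (1 : ℝ)) a * Uo a ^ 4) ≤ K ^ 2 * (CP * L ^ m * X4) := by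
    have hpt : ∀ a, D.indicator (fun _ => (1 : ℝ)) a * Uo a ^ 4 ≤ K ^ 2 * (D.indicator (fun _ => (1 : ℝ)) a * Uo a ^ 2) := by
      intro a
      by_cases ha : a ∈ D
      · rw [Set.indicator_of_mem ha, one_mul, one_mul]
        have hK2 : Uo a ^ 2 ≤ K ^ 2 := by
          have := bUo a ha; rw [← sq_abs]; exact pow_le_pow_left₀ (abs_nonneg _) this 2
        calc Uo a ^ 4 = Uo a ^ 2 * Uo a ^ 2 := by ring
          _ ≤ K ^ 2 * Uo a ^ 2 := mul_le_mul_of_nonneg_right hK2 (sq_nonneg _)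
      · rw [Set.indicator_of_notMem ha]; simp
    have hI : Integrable fun a => K ^ 2 * (D.indicator (fun _ => (1 : ℝ)) a * Uo a ^ 2) * gaussWeight β H a :=
      (iUo2D.const_mul (K ^ 2)).congr (Filter.Eventually.of_forall fun a => by ring)
    refine (EdgeChartGaussian.gaussAvg_mono_of_nonneg H hβ0 (ind0 (G := fun a => Uo a ^ 4) fun a => by positivity) hpt hI).trans ?_
    rw [EdgeChartGaussian.gaussAvg_const_mul]
    exact mul_le_mul_of_nonneg_left sUo2 (sq_nonneg K)
  -- (v) the even tilt part
  have bUes : ∀ a ∈ smallField H s, |Ue a| ≤ T := fun a ha => by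
    have h1 := hTs a ha
    have h2 := hTs (-a) ((EdgeChartGaussian.neg_mem_smallField_iff s a).2 ha)
    rw [hUe, abs_div, abs_two]; linarith [abs_add_le (U a) (U (-a))]
  have iUe : Integrable fun a => sfInd H s a * (Ue a - b) ^ 2 * gaussWeight β H a :=
    Tilt.integrable_sfInd_mul H hβ0 s ((mUe.sub measurable_const).pow_const 2) (sq_nonneg (T + |b|)) fun a ha => by
      rw [abs_pow]; exact pow_le_pow_left₀ (abs_nonneg _) ((abs_sub _ _).trans (add_le_add (bUes a ha) le_rfl)) 2
  have sUe : gaussAvg β H (fun a => D.indicator (fun _ => (1 : ℝ)) a * (Ue a - b) ^ 2) ≤ CP * L ^ m * X8 :=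
    (EdgeChartGaussian.gaussAvg_mono_of_nonneg H hβ0 (ind0 fun a => sq_nonneg _) (ind_le fun a => sq_nonneg _) iUe).trans hbe'
  -- ### the square roots
  have gnn : ∀ (G : (LandauFree H → E3) → ℝ), (∀ a, 0 ≤ G a) → 0 ≤ gaussAvg β H (fun a => D.indicator (fun _ => (1 : ℝ)) a * G a) :=
    fun G hG => EdgeChartGaussian.gaussAvg_nonneg H hβ0 (ind0 hG)
  -- √(2 E₀[1_D(Ue−b)²]) ≤ c₂ L^m √X8
  have rV : Real.sqrt (2 * gaussAvg β H (fun a => D.indicator (fun _ => (1 : ℝ)) a * (Ue a - b) ^ 2)) ≤ c₂ * L ^ m * Real.sqrt X8 := by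
    have h1 : 2 * gaussAvg β H (fun a => D.indicator (fun _ => (1 : ℝ)) a * (Ue a - b) ^ 2) ≤ (c₂ * L ^ m) * X8 := by
      have h2c : 2 * CP ≤ c₂ := le_max_right _ _
      have hLX : 0 ≤ L ^ m * X8 := by positivity
      calc 2 * gaussAvg β H (fun a => D.indicator (fun _ => (1 : ℝ)) a * (Ue a - b) ^ 2) ≤ 2 * (CP * L ^ m * X8) :=
            mul_le_mul_of_nonneg_left sUe zero_le_two
        _ = (2 * CP) * (L ^ m * X8) := by ring
        _ ≤ c₂ * (L ^ m * X8) := mul_le_mul_of_nonneg_right h2c hLX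
        _ = _ := by ring
    have hc : 1 ≤ c₂ * L ^ m := one_le_mul_of_one_le_of_one_le hc₂1 hLm1
    exact (Real.sqrt_le_sqrt h1).trans (sqrt_mul_le_of_one_le hc _)
  -- √(√(2E₀[1_D cᵒ⁴])·√(2E₀[1_D Uo⁴])) ≤ c₁ L^m √(√(s⁶/β³ · (K² X4)))
  have rA : ∀ z : Site 4, Real.sqrt (Real.sqrt (2 * gaussAvg β H (fun a => D.indicator (fun _ => (1 : ℝ)) a * chartPlaqCostOdd H z 1 2 a ^ 4)) *
      Real.sqrt (2 * gaussAvg β H (fun a => D.indicator (fun _ => (1 : ℝ)) a * Uo a ^ 4))) ≤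
      c₁ * L ^ m * Real.sqrt (Real.sqrt (s ^ 6 / β ^ 3 * (K ^ 2 * X4))) := by
    intro z
    have h0a := gnn (fun a => chartPlaqCostOdd H z 1 2 a ^ 4) fun a => by positivity
    have h0b := gnn (fun a => Uo a ^ 4) fun a => by positivity
    rw [← Real.sqrt_mul (by positivity)]
    have h1 : 2 * gaussAvg β H (fun a => D.indicator (fun _ => (1 : ℝ)) a * chartPlaqCostOdd H z 1 2 a ^ 4) *
        (2 * gaussAvg β H (fun a => D.indicator (fun _ => (1 : ℝ)) a * Uo a ^ 4)) ≤ (c₁ * L ^ m) * (s ^ 6 / β ^ 3 * (K ^ 2 * X4)) := by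
      have e1 := sO4 z
      have e2 := sUo4
      have hq : 0 ≤ 2 * (Co * s ^ 6 / β ^ 3) := by positivity
      have h4c : 4 * Co * CP ≤ c₁ := le_max_right _ _
      have h0 : 0 ≤ L ^ m * (s ^ 6 / β ^ 3 * (K ^ 2 * X4)) := by positivity
      calc 2 * gaussAvg β H (fun a => D.indicator (fun _ => (1 : ℝ)) a * chartPlaqCostOdd H z 1 2 a ^ 4) *
            (2 * gaussAvg β H (fun a => D.indicator (fun _ => (1 : ℝ)) a * Uo a ^ 4))
          ≤ 2 * (Co * s ^ 6 / β ^ 3) * (2 * (K ^ 2 * (CP * L ^ m * X4))) :=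
            mul_le_mul (mul_le_mul_of_nonneg_left e1 zero_le_two) (mul_le_mul_of_nonneg_left e2 zero_le_two)
              (mul_nonneg zero_le_two h0b) hq
        _ = (4 * Co * CP) * (L ^ m * (s ^ 6 / β ^ 3 * (K ^ 2 * X4))) := by ring
        _ ≤ c₁ * (L ^ m * (s ^ 6 / β ^ 3 * (K ^ 2 * X4))) := mul_le_mul_of_nonneg_right h4c h0
        _ = _ := by ring
    have hc : 1 ≤ c₁ * L ^ m := one_le_mul_of_one_le_of_one_le hc₁1 hLm1
    exact (Real.sqrt_le_sqrt (Real.sqrt_le_sqrt h1)).trans (sqrt_sqrt_mul_le_of_one_le hc _)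
  -- √(2E₀[1_D cᵒ²])·√(2E₀[1_D Uo²]) ≤ c₃ L^m √(X4/β³)
  have rB : ∀ z : Site 4, Real.sqrt (2 * gaussAvg β H (fun a => D.indicator (fun _ => (1 : ℝ)) a * chartPlaqCostOdd H z 1 2 a ^ 2)) *
      Real.sqrt (2 * gaussAvg β H (fun a => D.indicator (fun _ => (1 : ℝ)) a * Uo a ^ 2)) ≤ c₃ * L ^ m * Real.sqrt (X4 / β ^ 3) := by
    intro z
    have h0a := gnn (fun a => chartPlaqCostOdd H z 1 2 a ^ 2) fun a => sq_nonneg _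
    rw [← Real.sqrt_mul (by positivity)]
    have h1 : 2 * gaussAvg β H (fun a => D.indicator (fun _ => (1 : ℝ)) a * chartPlaqCostOdd H z 1 2 a ^ 2) *
        (2 * gaussAvg β H (fun a => D.indicator (fun _ => (1 : ℝ)) a * Uo a ^ 2)) ≤ (c₃ * L ^ m) * (X4 / β ^ 3) := by
      have e1 := sO2 z
      have hq : 0 ≤ 2 * (C₂ / β ^ 3) := by positivity
      have h4c : 4 * C₂ * CP ≤ c₃ := le_max_right _ _
      have h0 : 0 ≤ L ^ m * (X4 / β ^ 3) := by positivity
      have h0b := gnn (fun a => Uo a ^ 2) fun a => sq_nonneg _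
      calc 2 * gaussAvg β H (fun a => D.indicator (fun _ => (1 : ℝ)) a * chartPlaqCostOdd H z 1 2 a ^ 2) *
            (2 * gaussAvg β H (fun a => D.indicator (fun _ => (1 : ℝ)) a * Uo a ^ 2))
          ≤ 2 * (C₂ / β ^ 3) * (2 * (CP * L ^ m * X4)) :=
            mul_le_mul (mul_le_mul_of_nonneg_left e1 zero_le_two) (mul_le_mul_of_nonneg_left sUo2 zero_le_two)
              (mul_nonneg zero_le_two h0b) hq
        _ = (4 * C₂ * CP) * (L ^ m * (X4 / β ^ 3)) := by ring
        _ ≤ c₃ * (L ^ m * (X4 / β ^ 3)) := mul_le_mul_of_nonneg_right h4c h0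
        _ = _ := by ring
    have hc : 1 ≤ c₃ * L ^ m := one_le_mul_of_one_le_of_one_le hc₃1 hLm1
    exact (Real.sqrt_le_sqrt h1).trans (sqrt_mul_le_of_one_le hc _)
  -- ### assemble
  have hA := rA y
  have hA' := rA x
  have hBx := rB x
  have hBy := rB y
  set R4 := Real.sqrt (Real.sqrt (s ^ 6 / β ^ 3 * (K ^ 2 * X4))) with hR4
  set R2 := Real.sqrt (X4 / β ^ 3) with hR2
  set R8 := Real.sqrt X8 with hR8
  have hR40 : 0 ≤ R4 := Real.sqrt_nonneg _
  have hR20 : 0 ≤ R2 := Real.sqrt_nonneg _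
  have hR80 : 0 ≤ R8 := Real.sqrt_nonneg _
  have hLm2 : L ^ m * L ^ m = L ^ (2 * m) := by rw [← pow_add]; ring_nf
  have nV := Real.sqrt_nonneg (2 * gaussAvg β H (fun a => D.indicator (fun _ => (1 : ℝ)) a * (Ue a - b) ^ 2))
  have h2S : (0 : ℝ) ≤ 2 * (116 * s ^ 2) := by positivity
  have hLm0 : 0 ≤ L ^ m := by positivity
  have n1 : 0 ≤ c₁ * L ^ m * R4 := mul_nonneg (mul_nonneg (by linarith) hLm0) hR40
  have n2 : 0 ≤ c₂ * L ^ m * R8 := mul_nonneg (mul_nonneg (by linarith) hLm0) hR80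
  have n3 : 0 ≤ c₃ * L ^ m * R2 := mul_nonneg (mul_nonneg (by linarith) hLm0) hR20
  have nsq : ∀ (u v : ℝ), 0 ≤ Real.sqrt u * Real.sqrt v := fun u v => mul_nonneg (Real.sqrt_nonneg _) (Real.sqrt_nonneg _)
  have t1 : 2 * (116 * s ^ 2) * (Real.sqrt (Real.sqrt (2 * gaussAvg β H (fun a => D.indicator (fun _ => (1 : ℝ)) a * chartPlaqCostOdd H y 1 2 a ^ 4)) *
        Real.sqrt (2 * gaussAvg β H (fun a => D.indicator (fun _ => (1 : ℝ)) a * Uo a ^ 4)))) *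
      Real.sqrt (2 * gaussAvg β H (fun a => D.indicator (fun _ => (1 : ℝ)) a * (Ue a - b) ^ 2)) ≤
      2 * (116 * s ^ 2) * (c₁ * L ^ m * R4) * (c₂ * L ^ m * R8) :=
    mul_le_mul (mul_le_mul_of_nonneg_left hA h2S) rV nV (mul_nonneg h2S n1)
  have t2 : 2 * (116 * s ^ 2) * (Real.sqrt (Real.sqrt (2 * gaussAvg β H (fun a => D.indicator (fun _ => (1 : ℝ)) a * chartPlaqCostOdd H x 1 2 a ^ 4)) *
        Real.sqrt (2 * gaussAvg β H (fun a => D.indicator (fun _ => (1 : ℝ)) a * Uo a ^ 4)))) *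
      Real.sqrt (2 * gaussAvg β H (fun a => D.indicator (fun _ => (1 : ℝ)) a * (Ue a - b) ^ 2)) ≤
      2 * (116 * s ^ 2) * (c₁ * L ^ m * R4) * (c₂ * L ^ m * R8) :=
    mul_le_mul (mul_le_mul_of_nonneg_left hA' h2S) rV nV (mul_nonneg h2S n1)
  have t3 : Real.sqrt (2 * gaussAvg β H (fun a => D.indicator (fun _ => (1 : ℝ)) a * chartPlaqCostOdd H x 1 2 a ^ 2)) *
        Real.sqrt (2 * gaussAvg β H (fun a => D.indicator (fun _ => (1 : ℝ)) a * Uo a ^ 2)) *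
      (2 * (116 * s ^ 2) * Real.sqrt (2 * gaussAvg β H (fun a => D.indicator (fun _ => (1 : ℝ)) a * (Ue a - b) ^ 2))) ≤
      (c₃ * L ^ m * R2) * (2 * (116 * s ^ 2) * (c₂ * L ^ m * R8)) :=
    mul_le_mul hBx (mul_le_mul_of_nonneg_left rV h2S) (mul_nonneg h2S nV) n3
  have t4 : 2 * (116 * s ^ 2) * Real.sqrt (2 * gaussAvg β H (fun a => D.indicator (fun _ => (1 : ℝ)) a * (Ue a - b) ^ 2)) *
      (Real.sqrt (2 * gaussAvg β H (fun a => D.indicator (fun _ => (1 : ℝ)) a * chartPlaqCostOdd H y 1 2 a ^ 2)) *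
        Real.sqrt (2 * gaussAvg β H (fun a => D.indicator (fun _ => (1 : ℝ)) a * Uo a ^ 2))) ≤
      (2 * (116 * s ^ 2) * (c₂ * L ^ m * R8)) * (c₃ * L ^ m * R2) :=
    mul_le_mul (mul_le_mul_of_nonneg_left rV h2S) hBy (nsq _ _) (mul_nonneg h2S n2)
  refine (add_le_add (add_le_add (add_le_add t1 t2) t3) t4).trans ?_
  rw [show (2 * m) = m + m by ring, pow_add]
  have hextra : 0 ≤ 464 * s ^ 2 * (L ^ m * L ^ m) * (c₃ * c₂ * (R4 * R8) + c₁ * c₂ * (R2 * R8)) := by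
    have h1 : 0 ≤ c₃ * c₂ * (R4 * R8) := mul_nonneg (mul_nonneg (by linarith) (by linarith)) (mul_nonneg hR40 hR80)
    have h2 : 0 ≤ c₁ * c₂ * (R2 * R8) := mul_nonneg (mul_nonneg (by linarith) (by linarith)) (mul_nonneg hR20 hR80)
    have h3 : 0 ≤ 464 * s ^ 2 * (L ^ m * L ^ m) := by positivity
    exact mul_nonneg h3 (add_nonneg h1 h2)
  have hid : 464 * (c₁ * c₂ + c₃ * c₂) * (L ^ m * L ^ m) * s ^ 2 * (R4 + R2) * R8 =
      (2 * (116 * s ^ 2) * (c₁ * L ^ m * R4) * (c₂ * L ^ m * R8) + 2 * (116 * s ^ 2) * (c₁ * L ^ m * R4) * (c₂ * L ^ m * R8) +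
        (c₃ * L ^ m * R2) * (2 * (116 * s ^ 2) * (c₂ * L ^ m * R8)) + (2 * (116 * s ^ 2) * (c₂ * L ^ m * R8)) * (c₃ * L ^ m * R2)) +
      464 * s ^ 2 * (L ^ m * L ^ m) * (c₃ * c₂ * (R4 * R8) + c₁ * c₂ * (R2 * R8)) := by ring
  linarith only [hid, hextra]

end GaussNormalForm

end Summit.QuantumFields.YangMills.Theorems.AllWindowsColdBoxBoxHighLine

end
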